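import Summits.AtomisticToContinuum.Crystallization.Theorems.ChessboardParticlePlanesPeriodicWindowsShapeStationarity5
import Summits.AtomisticToContinuum.Crystallization.Theorems.ChargedEnergyGap.Negative.Unconditional

/-!
# Crux `PeriodicWindows` (stmt-AtomisticToContinuum-3240), line `Sketch` — stub E2a, part 6: averaging, limits, stationarity

Helper file for the registered stub `stub_shapeStationarity` (E2a) of the lead skeleton `PeriodicWindowsSketch`
(rev 9): the pure real-analysis end of the scaling argument, stated for ABSTRACT layer functions `σ₃, σ₆ : ℤ → ℝ` with
`1/2 ≤ σₙ ≤ Bₙ` and their layer averages `uₙ(K) = (2K+1)⁻¹ ∑_{|k| ≤ K} σₙ(k)`.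

* `shp_avg_bounds`, `shp_avg_sq_le`, `shp_avg_linear_le` — bounds and Jensen/linearity for the layer averages;
* `shp_abstract_stationarity` — **the abstract stationarity lemma**: if a real sequence `g` tends to `2 e*`, and for
  some vanishing error sequences `2 (α₁ u₆ − β₁ u₃) ≤ g + C d` (the window bound (U) at scale `a`) and, for every
  `λ > 0`, `g ≤ 2 (α_λ u₆ − β_λ u₃) + C_λ d_λ` (the free bound (L) at scale `λ a`), where `α_λ = ((λa)²)⁻⁶/12`,
  `β_λ = ((λa)²)⁻³/6`, then along a subsequence `(u₃, u₆) → (L₃, L₆)` with `L₆ = a⁶ L₃` (Fermat at `λ = 1`) and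
  `L₃² ≥ -12 e₁ L₆` for every `e₁ ≥ e*`; consequently SOME layer realises each of the three site inequalities of the stub
  up to `η` (contradiction through the averages).

All `[folklore]`.
-/

noncomputable section

namespace Summit.AtomisticToContinuum.Crystallization.Theorems.PeriodicWindowsSketch

open Filter Topology

/-! ## Layer averages -/

/-- `#[-K, K] = 2K+1`. [folklore] -/
theorem shp_card_Icc (K : ℕ) : ((Finset.Icc (-(K : ℤ)) K).card : ℝ) = ((2 * K + 1 : ℕ) : ℝ) := by
  rw [Int.card_Icc]
  have : ((K : ℤ) + 1 - -(K : ℤ)).toNat = 2 * K + 1 := by omega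
  rw [this]

/-- Bounds pass to the layer averages. [folklore] -/
theorem shp_avg_bounds {σ : ℤ → ℝ} {b B : ℝ} (hσ : ∀ k, b ≤ σ k ∧ σ k ≤ B) (K : ℕ) :
    b ≤ (∑ k ∈ Finset.Icc (-(K : ℤ)) K, σ k) / ((2 * K + 1 : ℕ) : ℝ) ∧
      (∑ k ∈ Finset.Icc (-(K : ℤ)) K, σ k) / ((2 * K + 1 : ℕ) : ℝ) ≤ B := by
  have hm : (0 : ℝ) < ((2 * K + 1 : ℕ) : ℝ) := by positivity
  have h1 : ∑ _k ∈ Finset.Icc (-(K : ℤ)) K, b ≤ ∑ k ∈ Finset.Icc (-(K : ℤ)) K, σ k :=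
    Finset.sum_le_sum fun k _ => (hσ k).1
  have h2 : ∑ k ∈ Finset.Icc (-(K : ℤ)) K, σ k ≤ ∑ _k ∈ Finset.Icc (-(K : ℤ)) K, B :=
    Finset.sum_le_sum fun k _ => (hσ k).2
  rw [Finset.sum_const, nsmul_eq_mul, shp_card_Icc] at h1 h2
  constructor
  · rw [le_div_iff₀ hm]; linarith
  · rw [div_le_iff₀ hm]; linarith

/-- **Jensen for the square through the averages**: if `σ₃(k)² ≤ M σ₆(k)` for all `k` then `u₃(K)² ≤ M u₆(K)`
(Cauchy–Schwarz `(∑ σ₃)² ≤ (2K+1) ∑ σ₃²`). [folklore] -/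
theorem shp_avg_sq_le {σ3 σ6 : ℤ → ℝ} {M : ℝ} (h : ∀ k, σ3 k ^ 2 ≤ M * σ6 k) (K : ℕ) :
    ((∑ k ∈ Finset.Icc (-(K : ℤ)) K, σ3 k) / ((2 * K + 1 : ℕ) : ℝ)) ^ 2 ≤
      M * ((∑ k ∈ Finset.Icc (-(K : ℤ)) K, σ6 k) / ((2 * K + 1 : ℕ) : ℝ)) := by
  have hm : (0 : ℝ) < ((2 * K + 1 : ℕ) : ℝ) := by positivity
  have hcs := sq_sum_le_card_mul_sum_sq (s := Finset.Icc (-(K : ℤ)) K) (f := σ3)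
  rw [shp_card_Icc] at hcs
  have hsum : ∑ k ∈ Finset.Icc (-(K : ℤ)) K, σ3 k ^ 2 ≤ M * ∑ k ∈ Finset.Icc (-(K : ℤ)) K, σ6 k := by
    rw [Finset.mul_sum]; exact Finset.sum_le_sum fun k _ => h k
  rw [div_pow, div_le_iff₀ (by positivity)]
  calc (∑ k ∈ Finset.Icc (-(K : ℤ)) K, σ3 k) ^ 2 ≤ ((2 * K + 1 : ℕ) : ℝ) * ∑ k ∈ Finset.Icc (-(K : ℤ)) K, σ3 k ^ 2 := hcs
    _ ≤ ((2 * K + 1 : ℕ) : ℝ) * (M * ∑ k ∈ Finset.Icc (-(K : ℤ)) K, σ6 k) := mul_le_mul_of_nonneg_left hsum hm.le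
    _ = M * ((∑ k ∈ Finset.Icc (-(K : ℤ)) K, σ6 k) / ((2 * K + 1 : ℕ) : ℝ)) * ((2 * K + 1 : ℕ) : ℝ) ^ 2 := by
        field_simp

/-- Linear inequalities pass to the averages: if `M σ₃(k) ≤ σ₆(k)` for all `k` then `M u₃(K) ≤ u₆(K)`. [folklore] -/
theorem shp_avg_linear_le {σ3 σ6 : ℤ → ℝ} {M : ℝ} (h : ∀ k, M * σ3 k ≤ σ6 k) (K : ℕ) :
    M * ((∑ k ∈ Finset.Icc (-(K : ℤ)) K, σ3 k) / ((2 * K + 1 : ℕ) : ℝ)) ≤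
      (∑ k ∈ Finset.Icc (-(K : ℤ)) K, σ6 k) / ((2 * K + 1 : ℕ) : ℝ) := by
  have hm : (0 : ℝ) < ((2 * K + 1 : ℕ) : ℝ) := by positivity
  have hsum : M * ∑ k ∈ Finset.Icc (-(K : ℤ)) K, σ3 k ≤ ∑ k ∈ Finset.Icc (-(K : ℤ)) K, σ6 k := by
    rw [Finset.mul_sum]; exact Finset.sum_le_sum fun k _ => h k
  rw [← mul_div_assoc, div_le_div_iff_of_pos_right hm]
  exact hsum

/-- … and if `σ₆(k) ≤ M σ₃(k)` for all `k` then `u₆(K) ≤ M u₃(K)`. [folklore] -/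
theorem shp_avg_linear_ge {σ3 σ6 : ℤ → ℝ} {M : ℝ} (h : ∀ k, σ6 k ≤ M * σ3 k) (K : ℕ) :
    (∑ k ∈ Finset.Icc (-(K : ℤ)) K, σ6 k) / ((2 * K + 1 : ℕ) : ℝ) ≤
      M * ((∑ k ∈ Finset.Icc (-(K : ℤ)) K, σ3 k) / ((2 * K + 1 : ℕ) : ℝ)) := by
  have hm : (0 : ℝ) < ((2 * K + 1 : ℕ) : ℝ) := by positivity
  have hsum : ∑ k ∈ Finset.Icc (-(K : ℤ)) K, σ6 k ≤ M * ∑ k ∈ Finset.Icc (-(K : ℤ)) K, σ3 k := by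
    rw [Finset.mul_sum]; exact Finset.sum_le_sum fun k _ => h k
  rw [← mul_div_assoc, div_le_div_iff_of_pos_right hm]
  exact hsum

/-! ## Two elementary limits -/

/-- `((1 + 1/(n+1))²)⁻³ → 1`. [folklore] -/
theorem shp_tendsto_shrink :
    Tendsto (fun n : ℕ => (((1 + 1 / ((n : ℝ) + 1)) ^ 2)⁻¹) ^ 3) atTop (𝓝 1) := by
  have h0 : Tendsto (fun n : ℕ => 1 + 1 / ((n : ℝ) + 1)) atTop (𝓝 (1 + 0)) :=
    tendsto_const_nhds.add tendsto_one_div_add_atTop_nhds_zero_nat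
  have h1 := ((h0.pow 2).inv₀ (by norm_num)).pow 3
  simpa using h1

/-- `((1 + 1/(n+1))²)³ → 1` (the reciprocal scales). [folklore] -/
theorem shp_tendsto_grow :
    Tendsto (fun n : ℕ => ((((1 + 1 / ((n : ℝ) + 1))⁻¹) ^ 2)⁻¹) ^ 3) atTop (𝓝 1) := by
  have h0 : Tendsto (fun n : ℕ => 1 + 1 / ((n : ℝ) + 1)) atTop (𝓝 (1 + 0)) :=
    tendsto_const_nhds.add tendsto_one_div_add_atTop_nhds_zero_nat
  have h1 := (h0.pow 2).pow 3
  simp only [add_zero, one_pow] at h1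
  refine h1.congr fun n => ?_
  simp only [inv_pow, inv_inv]

/-! ## The abstract stationarity lemma -/

/-- **Abstract scaling stationarity.** Let `σ₃, σ₆ : ℤ → ℝ` with `1/2 ≤ σₙ ≤ Bₙ`, `a > 0`, `e* : ℝ`, a sequence
`g → 2 e*`, and assume the window bound (U) at scale `a` and the free bounds (L) at every scale `λ a` hold on the
layer averages with vanishing errors. Then (i) for every `e₁ ≥ e*` and `η > 0` some layer has
`(-12 e₁ − η) σ₆(m) ≤ σ₃(m)²`; (ii) for every `η > 0` some layer has `σ₆(m) ≤ (a⁶ + η) σ₃(m)`; (iii) for every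
`η > 0` some layer has `(a⁶ − η) σ₃(m) ≤ σ₆(m)`. [folklore] -/
theorem shp_abstract_stationarity (σ3 σ6 : ℤ → ℝ) {B3 B6 : ℝ} (hb3 : ∀ k, 1 / 2 ≤ σ3 k ∧ σ3 k ≤ B3)
    (hb6 : ∀ k, 1 / 2 ≤ σ6 k ∧ σ6 k ≤ B6) {a : ℝ} (ha : 0 < a) (estar : ℝ) (g : ℕ → ℝ)
    (hg : Tendsto g atTop (𝓝 (2 * estar)))
    (hU : ∃ (C : ℝ) (d : ℕ → ℝ), Tendsto d atTop (𝓝 0) ∧ ∀ K : ℕ,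
      2 * ((1 / 12) * ((a ^ 2)⁻¹ ^ 6 * ((∑ k ∈ Finset.Icc (-(K : ℤ)) K, σ6 k) / ((2 * K + 1 : ℕ) : ℝ))) -
        (1 / 6) * ((a ^ 2)⁻¹ ^ 3 * ((∑ k ∈ Finset.Icc (-(K : ℤ)) K, σ3 k) / ((2 * K + 1 : ℕ) : ℝ)))) ≤
        g K + C * d K)
    (hL : ∀ l : ℝ, 0 < l → ∃ (C : ℝ) (d : ℕ → ℝ), Tendsto d atTop (𝓝 0) ∧ ∀ K : ℕ,
      g K ≤ 2 * ((1 / 12) * (((l * a) ^ 2)⁻¹ ^ 6 * ((∑ k ∈ Finset.Icc (-(K : ℤ)) K, σ6 k) / ((2 * K + 1 : ℕ) : ℝ))) -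
        (1 / 6) * (((l * a) ^ 2)⁻¹ ^ 3 * ((∑ k ∈ Finset.Icc (-(K : ℤ)) K, σ3 k) / ((2 * K + 1 : ℕ) : ℝ)))) +
        C * d K) :
    (∀ e₁ : ℝ, estar ≤ e₁ → ∀ η : ℝ, 0 < η → ∃ m : ℤ, (-(12 * e₁) - η) * σ6 m ≤ (σ3 m) ^ 2) ∧
    (∀ η : ℝ, 0 < η → ∃ m : ℤ, σ6 m ≤ (a ^ 6 + η) * σ3 m) ∧
    (∀ η : ℝ, 0 < η → ∃ m : ℤ, (a ^ 6 - η) * σ3 m ≤ σ6 m) := by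
  -- layer averages and their bounds
  set u3 : ℕ → ℝ := fun K => (∑ k ∈ Finset.Icc (-(K : ℤ)) K, σ3 k) / ((2 * K + 1 : ℕ) : ℝ) with hu3
  set u6 : ℕ → ℝ := fun K => (∑ k ∈ Finset.Icc (-(K : ℤ)) K, σ6 k) / ((2 * K + 1 : ℕ) : ℝ) with hu6
  have hu3b : ∀ K, 1 / 2 ≤ u3 K ∧ u3 K ≤ B3 := fun K => shp_avg_bounds hb3 K
  have hu6b : ∀ K, 1 / 2 ≤ u6 K ∧ u6 K ≤ B6 := fun K => shp_avg_bounds hb6 K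
  -- a convergent subsequence of `(u3, u6)`
  set S : Set (ℝ × ℝ) := Set.Icc (1 / 2) B3 ×ˢ Set.Icc (1 / 2) B6 with hS
  have hSb : Bornology.IsBounded S := (Metric.isBounded_Icc _ _).prod (Metric.isBounded_Icc _ _)
  have hSc : IsClosed S := isClosed_Icc.prod isClosed_Icc
  have hmem : ∀ K, (u3 K, u6 K) ∈ S := fun K =>
    Set.mk_mem_prod ⟨(hu3b K).1, (hu3b K).2⟩ ⟨(hu6b K).1, (hu6b K).2⟩
  obtain ⟨p, hp, φ, hφ, hlim⟩ := tendsto_subseq_of_bounded hSb hmem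
  rw [hSc.closure_eq] at hp
  set L3 : ℝ := p.1 with hL3def
  set L6 : ℝ := p.2 with hL6def
  have hL3 : Tendsto (fun j => u3 (φ j)) atTop (𝓝 L3) := (continuous_fst.tendsto p).comp hlim
  have hL6 : Tendsto (fun j => u6 (φ j)) atTop (𝓝 L6) := (continuous_snd.tendsto p).comp hlim
  have hL3pos : 1 / 2 ≤ L3 := hp.1.1
  have hL6pos : 1 / 2 ≤ L6 := hp.2.1
  have hφt : Tendsto φ atTop atTop := hφ.tendsto_atTop
  -- the scaled energy functional at the limit
  set F : ℝ → ℝ := fun l => 2 * ((1 / 12) * (((l * a) ^ 2)⁻¹ ^ 6 * L6) - (1 / 6) * (((l * a) ^ 2)⁻¹ ^ 3 * L3))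
    with hF
  -- Claim A: `F 1 ≤ 2 e*`
  have hA : F 1 ≤ 2 * estar := by
    obtain ⟨C, d, hd, hineq⟩ := hU
    have hl : Tendsto (fun j => 2 * ((1 / 12) * ((a ^ 2)⁻¹ ^ 6 * u6 (φ j)) - (1 / 6) * ((a ^ 2)⁻¹ ^ 3 * u3 (φ j))))
        atTop (𝓝 (2 * ((1 / 12) * ((a ^ 2)⁻¹ ^ 6 * L6) - (1 / 6) * ((a ^ 2)⁻¹ ^ 3 * L3)))) :=
      ((hL6.const_mul _).const_mul _).sub ((hL3.const_mul _).const_mul _) |>.const_mul 2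
    have hr : Tendsto (fun j => g (φ j) + C * d (φ j)) atTop (𝓝 (2 * estar + C * 0)) :=
      (hg.comp hφt).add ((hd.comp hφt).const_mul C)
    rw [mul_zero, add_zero] at hr
    have := le_of_tendsto_of_tendsto' hl hr fun j => hineq (φ j)
    simp only [hF, one_mul]
    exact this
  -- Claim B: `2 e* ≤ F l` for every `l > 0`
  have hB : ∀ l : ℝ, 0 < l → 2 * estar ≤ F l := by
    intro l hl0
    obtain ⟨C, d, hd, hineq⟩ := hL l hl0
    have hl : Tendsto (fun j => 2 * ((1 / 12) * (((l * a) ^ 2)⁻¹ ^ 6 * u6 (φ j)) -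
        (1 / 6) * (((l * a) ^ 2)⁻¹ ^ 3 * u3 (φ j))) + C * d (φ j)) atTop (𝓝 (F l + C * 0)) :=
      ((((hL6.const_mul _).const_mul _).sub ((hL3.const_mul _).const_mul _)).const_mul 2).add
        ((hd.comp hφt).const_mul C)
    rw [mul_zero, add_zero] at hl
    exact le_of_tendsto_of_tendsto' (hg.comp hφt) hl fun j => hineq (φ j)
  -- hence `F 1 ≤ F l` for all `l > 0`: Fermat at `l = 1`
  set α : ℝ := (1 / 12) * ((a ^ 2)⁻¹ ^ 6 * L6) with hα
  set β : ℝ := (1 / 6) * ((a ^ 2)⁻¹ ^ 3 * L3) with hβ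
  have hαpos : 0 < α := by positivity
  have hFv : ∀ l : ℝ, 0 < l → F l = 2 * (α * (((l ^ 2)⁻¹) ^ 3) ^ 2 - β * ((l ^ 2)⁻¹) ^ 3) := by
    intro l _
    simp only [hF, hα, hβ]
    rw [mul_pow, mul_inv, mul_pow, mul_pow, ← pow_mul]
    ring
  have hF1 : F 1 = 2 * (α - β) := by rw [hFv 1 one_pos]; norm_num
  have hdiff : ∀ l : ℝ, 0 < l → 0 ≤ (((l ^ 2)⁻¹) ^ 3 - 1) * (α * (((l ^ 2)⁻¹) ^ 3 + 1) - β) := by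
    intro l hl0
    have h := (hA.trans (hB l hl0))
    rw [hF1, hFv l hl0] at h
    nlinarith
  -- scales slightly above `1`: `v < 1`, so `α (v + 1) ≤ β`
  have hle : 2 * α - β ≤ 0 := by
    have hv : ∀ n : ℕ, α * ((((1 + 1 / ((n : ℝ) + 1)) ^ 2)⁻¹) ^ 3 + 1) - β ≤ 0 := by
      intro n
      set l : ℝ := 1 + 1 / ((n : ℝ) + 1) with hl
      have hpos : (0 : ℝ) < 1 / ((n : ℝ) + 1) := by positivity
      have hl1 : 1 < l := by rw [hl]; linarith
      have hl0 : 0 < l := by linarith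
      have hvlt : ((l ^ 2)⁻¹) ^ 3 < 1 := by
        have h2 : 1 < l ^ 2 := by nlinarith
        exact pow_lt_one₀ (by positivity) (inv_lt_one_of_one_lt₀ h2) (by norm_num)
      have h := hdiff l hl0
      by_contra hcon
      push Not at hcon
      have : (((l ^ 2)⁻¹) ^ 3 - 1) * (α * (((l ^ 2)⁻¹) ^ 3 + 1) - β) < 0 :=
        mul_neg_of_neg_of_pos (by linarith) hcon
      linarith
    have hlimv : Tendsto (fun n : ℕ => α * ((((1 + 1 / ((n : ℝ) + 1)) ^ 2)⁻¹) ^ 3 + 1) - β) atTop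
        (𝓝 (α * (1 + 1) - β)) :=
      ((shp_tendsto_shrink.add tendsto_const_nhds).const_mul α).sub tendsto_const_nhds
    have := le_of_tendsto' hlimv hv
    linarith
  -- scales slightly below `1`: `v > 1`, so `β ≤ α (v + 1)`
  have hge : 0 ≤ 2 * α - β := by
    have hv : ∀ n : ℕ, 0 ≤ α * (((((1 + 1 / ((n : ℝ) + 1))⁻¹) ^ 2)⁻¹) ^ 3 + 1) - β := by
      intro n
      set t : ℝ := 1 + 1 / ((n : ℝ) + 1) with ht
      have hpos : (0 : ℝ) < 1 / ((n : ℝ) + 1) := by positivity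
      have ht1 : 1 < t := by rw [ht]; linarith
      have ht0 : 0 < t := by linarith
      have hl0 : 0 < t⁻¹ := by positivity
      have hvgt : 1 < (((t⁻¹) ^ 2)⁻¹) ^ 3 := by
        have h2 : 1 < t ^ 2 := by nlinarith
        have h3 : 1 < (t ^ 2) ^ 3 := one_lt_pow₀ h2 (by norm_num)
        simpa only [inv_pow, inv_inv] using h3
      have h := hdiff t⁻¹ hl0
      by_contra hcon
      push Not at hcon
      have : (((t⁻¹ ^ 2)⁻¹) ^ 3 - 1) * (α * (((t⁻¹ ^ 2)⁻¹) ^ 3 + 1) - β) < 0 :=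
        mul_neg_of_pos_of_neg (by linarith) hcon
      linarith
    have hlimv : Tendsto (fun n : ℕ => α * (((((1 + 1 / ((n : ℝ) + 1))⁻¹) ^ 2)⁻¹) ^ 3 + 1) - β) atTop
        (𝓝 (α * (1 + 1) - β)) :=
      ((shp_tendsto_grow.add tendsto_const_nhds).const_mul α).sub tendsto_const_nhds
    have := ge_of_tendsto' hlimv hv
    linarith
  have hβα : β = 2 * α := by linarith
  -- consequences: `L6 = a⁶ L3` and `L3 ≥ -12 e₁ a⁶` for `e₁ ≥ e*`
  have ha6 : 0 < a ^ 6 := by positivity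
  have hinv3 : (a ^ 2)⁻¹ ^ 3 = (a ^ 6)⁻¹ := by rw [inv_pow, ← pow_mul]
  have hinv6 : (a ^ 2)⁻¹ ^ 6 = (a ^ 6)⁻¹ * (a ^ 6)⁻¹ := by
    rw [inv_pow, ← pow_mul, ← mul_inv, ← pow_add]
  have hL6eq : L6 = a ^ 6 * L3 := by
    have h := hβα
    simp only [hα, hβ, hinv3, hinv6] at h
    field_simp at h
    nlinarith [h]
  have hL3ge : ∀ e₁ : ℝ, estar ≤ e₁ → -(12 * e₁) * a ^ 6 ≤ L3 := by
    intro e₁ he₁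
    have h1 : F 1 ≤ 2 * e₁ := hA.trans (by linarith)
    rw [hF1, hβα] at h1
    -- `-α ≤ e₁` with `α = (a⁶)⁻² L6 / 12 = (a⁶)⁻¹ L3 / 12`
    have h2 : -e₁ ≤ α := by linarith
    simp only [hα, hinv6, hL6eq] at h2
    field_simp at h2
    linarith [h2]
  refine ⟨?_, ?_, ?_⟩
  · -- (i) through Jensen on the averages
    intro e₁ he₁ η hη
    by_contra hcon
    push Not at hcon
    have hK : ∀ K, (u3 K) ^ 2 ≤ (-(12 * e₁) - η) * u6 K := fun K =>
      shp_avg_sq_le (σ3 := σ3) (σ6 := σ6) (M := -(12 * e₁) - η) (fun k => (hcon k).le) K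
    have hlim2 := le_of_tendsto_of_tendsto' (hL3.pow 2) (hL6.const_mul (-(12 * e₁) - η)) fun j => hK (φ j)
    have h3 := hL3ge e₁ he₁
    -- `L3² ≥ -12 e₁ L6` and `L3² ≤ (-12 e₁ - η) L6` with `L6 ≥ 1/2`
    have h4 : -(12 * e₁) * L6 ≤ L3 ^ 2 := by
      rw [hL6eq]; nlinarith [h3, hL3pos]
    nlinarith [hlim2, h4, hL6pos, hη]
  · -- (ii) linear averaging
    intro η hη
    by_contra hcon
    push Not at hcon
    have hK : ∀ K, (a ^ 6 + η) * u3 K ≤ u6 K := fun K =>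
      shp_avg_linear_le (σ3 := σ3) (σ6 := σ6) (M := a ^ 6 + η) (fun k => (hcon k).le) K
    have hlim2 := le_of_tendsto_of_tendsto' (hL3.const_mul (a ^ 6 + η)) hL6 fun j => hK (φ j)
    rw [hL6eq] at hlim2
    nlinarith [hlim2, hL3pos, hη]
  · -- (iii) linear averaging
    intro η hη
    by_contra hcon
    push Not at hcon
    have hK : ∀ K, u6 K ≤ (a ^ 6 - η) * u3 K := fun K =>
      shp_avg_linear_ge (σ3 := σ3) (σ6 := σ6) (M := a ^ 6 - η) (fun k => (hcon k).le) K
    have hlim2 := le_of_tendsto_of_tendsto' hL6 (hL3.const_mul (a ^ 6 - η)) fun j => hK (φ j)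
    rw [hL6eq] at hlim2
    nlinarith [hlim2, hL3pos, hη]

end Summit.AtomisticToContinuum.Crystallization.Theorems.PeriodicWindowsSketch

end
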